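import Literature.MathematicalPhysics.StatisticalMechanics.LennardJonesClusters

/-!
# `KeplerBound` (stmt-AtomisticToContinuum-11961) from local limits, I: the multi-particle
# removal inequality in Lennard-Jones ground states

Support file for the item `ThreeConeCertificate.KeplerBound`.  The one finite-`N` input of the
argument "periodic local limits of translated ground states are periodic minimisers" (part III):

**Removal inequality** (`sum_siteEnergy_sub_le_groundStateEnergy`).  In a Lennard-Jones ground
state `x` of `N` particles in `ℝ³`, for every set `S` of `n` particles,
`Σ_{i ∈ S} 𝓔ⁱ(x) − ½ Σ_{i,k ∈ S} V(|x i − x k|) ≤ E(n)`: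
replace the particles of `S` by a far-away translate of an `n`-particle ground state (all cross
distances `> 1`, where `V_LJ < 0`), keep the others, and compare with `E(N) = 𝓔(x)` through the
full double sums (`two_mul_interactionEnergy_eq_sum_sum`, `sum_sum_eq_add_compl` of the tree).
For `S = {i}` this is the removal inequality `𝓔ⁱ(x) ≤ E(1) = 0` of `LennardJonesClusters.lean`.
All `[folklore]` (Blanc–Lewin 2015, §1.2: "two groups of particles far away always attract each
other").
-/

noncomputable section

open scoped BigOperators
open Metric

namespace Summit.AtomisticToContinuum.Crystallization.Theorems.KeplerBoundLocalLimit

open Literature.MathematicalPhysics.StatisticalMechanics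

local notation "E3" => EuclideanSpace ℝ (Fin 3)

/-- **Far placement.** Given two finite families of points of `ℝ³` there is a translation of the
second putting all its points at distance `> 1` from all points of the first. [folklore] -/
theorem exists_far_shift {N n : ℕ} (x : Fin N → E3) (z : Fin n → E3) :
    ∃ c : E3, ∀ k a, 1 < dist (x k) (z a + c) := by
  set R : ℝ := 2 + ∑ i, ‖x i‖ + ∑ j, ‖z j‖ with hR
  set c : E3 := EuclideanSpace.single (0 : Fin 3) R with hc_def
  have hR0 : 0 ≤ R :=
    add_nonneg (add_nonneg zero_le_two (Finset.sum_nonneg fun _ _ => norm_nonneg _))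
      (Finset.sum_nonneg fun _ _ => norm_nonneg _)
  have hcn : ‖c‖ = R := by simp [hc_def, abs_of_nonneg hR0]
  refine ⟨c, fun i j => ?_⟩
  have hyi : ‖x i‖ ≤ ∑ i', ‖x i'‖ :=
    Finset.single_le_sum (f := fun i' => ‖x i'‖) (fun _ _ => norm_nonneg _) (Finset.mem_univ i)
  have hzj : ‖z j‖ ≤ ∑ j', ‖z j'‖ :=
    Finset.single_le_sum (f := fun j' => ‖z j'‖) (fun _ _ => norm_nonneg _) (Finset.mem_univ j)
  have h1 : ‖c‖ - ‖x i - z j‖ ≤ dist (x i) (z j + c) := by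
    rw [dist_comm, dist_eq_norm]
    have e : c - (z j + c - x i) = x i - z j := by abel
    have := norm_sub_norm_le c (z j + c - x i)
    rw [e] at this
    linarith
  have h2 : ‖x i - z j‖ ≤ ‖x i‖ + ‖z j‖ := norm_sub_le _ _
  linarith

/-- The site energy is the full row sum (`V_LJ(0) = 0`). [folklore] -/
theorem siteEnergy_eq_sum {N : ℕ} (x : Fin N → E3) (i : Fin N) :
    siteEnergy lennardJones x i = ∑ k, lennardJones (dist (x i) (x k)) := by
  unfold siteEnergy
  rw [← Finset.add_sum_erase Finset.univ _ (Finset.mem_univ i), dist_self, lennardJones_zero,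
    zero_add]

/-- **The multi-particle removal inequality.** In a Lennard-Jones ground state `x` of `N`
particles in `ℝ³`, for every set `S` of particles,
`Σ_{i ∈ S} 𝓔ⁱ(x) − ½ Σ_{i ∈ S} Σ_{k ∈ S} V_LJ(|x i − x k|) ≤ E(#S)`.
(Replace the particles of `S` by a far translate of a ground state of `#S` particles.)
[folklore] -/
theorem sum_siteEnergy_sub_le_groundStateEnergy {N : ℕ} {x : Fin N → E3}
    (hx : IsGroundState lennardJones x) (S : Finset (Fin N)) :
    ∑ i ∈ S, siteEnergy lennardJones x i -
        1 / 2 * ∑ i ∈ S, ∑ k ∈ S, lennardJones (dist (x i) (x k)) ≤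
      groundStateEnergy lennardJones 3 S.card := by
  classical
  -- an `#S`-particle ground state, translated far away
  obtain ⟨z, hz⟩ := LennardJonesGroundStatesExist_holds S.card
  obtain ⟨c, hfar⟩ := exists_far_shift x z
  set e := S.equivFin with he
  set x' : Fin N → E3 := fun k => if h : k ∈ S then z (e ⟨k, h⟩) + c else x k with hx'
  have hx'S : ∀ k (h : k ∈ S), x' k = z (e ⟨k, h⟩) + c := fun k h => by simp [hx', h]
  have hx'c : ∀ k, k ∉ S → x' k = x k := fun k h => by simp [hx', h]
  -- the competitor consists of distinct points
  have hinj : Function.Injective x' := by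
    intro k l hkl
    by_cases hk : k ∈ S <;> by_cases hl : l ∈ S
    · rw [hx'S k hk, hx'S l hl] at hkl
      have h1 := hz.1 (add_right_cancel hkl)
      have h2 := e.injective h1
      exact congrArg Subtype.val h2
    · rw [hx'S k hk, hx'c l hl] at hkl
      have := hfar l (e ⟨k, hk⟩)
      rw [← hkl, dist_self] at this
      exact absurd this (by norm_num)
    · rw [hx'c k hk, hx'S l hl] at hkl
      have := hfar k (e ⟨l, hl⟩)
      rw [hkl, dist_self] at this
      exact absurd this (by norm_num)
    · rw [hx'c k hk, hx'c l hl] at hkl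
      exact hx.1 hkl
  have hmin : interactionEnergy lennardJones x ≤ interactionEnergy lennardJones x' := by
    rw [hx.2]; exact groundStateEnergy_lennardJones_le hinj
  -- double sums
  have h2 := two_mul_interactionEnergy_eq_sum_sum lennardJones lennardJones_zero x
  have h2' := two_mul_interactionEnergy_eq_sum_sum lennardJones lennardJones_zero x'
  rw [sum_sum_eq_add_compl _ S] at h2 h2'
  -- (a) outside `S` nothing changes
  have hcc : ∑ i ∈ Sᶜ, ∑ k ∈ Sᶜ, lennardJones (dist (x' i) (x' k)) =
      ∑ i ∈ Sᶜ, ∑ k ∈ Sᶜ, lennardJones (dist (x i) (x k)) :=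
    Finset.sum_congr rfl fun i hi => Finset.sum_congr rfl fun k hk => by
      rw [hx'c i (Finset.mem_compl.1 hi), hx'c k (Finset.mem_compl.1 hk)]
  -- (b) inside `S` the competitor is the translated ground state `z`
  have hSS : ∑ i ∈ S, ∑ k ∈ S, lennardJones (dist (x' i) (x' k)) =
      2 * groundStateEnergy lennardJones 3 S.card := by
    have hrow : ∀ i ∈ S, ∑ k ∈ S, lennardJones (dist (x' i) (x' k)) =
        ∑ b : Fin S.card, lennardJones (dist (x' i) (z b + c)) := by
      intro i _
      rw [← Finset.sum_coe_sort S]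
      rw [← e.sum_comp (fun b => lennardJones (dist (x' i) (z b + c)))]
      exact Finset.sum_congr rfl fun k _ => by rw [hx'S k.1 k.2]
    rw [Finset.sum_congr rfl hrow, ← Finset.sum_coe_sort S]
    have h1 : ∀ a : ↥S, ∑ b : Fin S.card, lennardJones (dist (x' a) (z b + c)) =
        ∑ b : Fin S.card, lennardJones (dist (z (e a) + c) (z b + c)) := fun a => by
      rw [hx'S a.1 a.2]
    rw [Finset.sum_congr rfl fun a _ => h1 a]
    have h3 : ∑ a : ↥S, ∑ b : Fin S.card, lennardJones (dist (z (e a) + c) (z b + c)) =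
        ∑ a' : Fin S.card, ∑ b : Fin S.card, lennardJones (dist (z a' + c) (z b + c)) :=
      e.sum_comp (fun a' => ∑ b : Fin S.card, lennardJones (dist (z a' + c) (z b + c)))
    rw [h3, ← hz.2, two_mul_interactionEnergy_eq_sum_sum lennardJones lennardJones_zero z]
    exact Finset.sum_congr rfl fun a _ => Finset.sum_congr rfl fun b _ => by
      rw [dist_add_right]
  -- (c) the new cross terms are negative
  have hcross1 : ∑ i ∈ S, ∑ k ∈ Sᶜ, lennardJones (dist (x' i) (x' k)) ≤ 0 :=
    Finset.sum_nonpos fun i hi => Finset.sum_nonpos fun k hk => by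
      rw [hx'S i hi, hx'c k (Finset.mem_compl.1 hk), dist_comm]
      exact (lennardJones_neg (hfar k _)).le
  have hcross2 : ∑ i ∈ Sᶜ, ∑ k ∈ S, lennardJones (dist (x' i) (x' k)) ≤ 0 :=
    Finset.sum_nonpos fun i hi => Finset.sum_nonpos fun k hk => by
      rw [hx'c i (Finset.mem_compl.1 hi), hx'S k hk]
      exact (lennardJones_neg (hfar i _)).le
  -- (d) for `x`: the two cross blocks coincide, and `Σ_{i ∈ S} 𝓔ⁱ = SS + cross`
  have hsym : ∑ i ∈ Sᶜ, ∑ k ∈ S, lennardJones (dist (x i) (x k)) =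
      ∑ i ∈ S, ∑ k ∈ Sᶜ, lennardJones (dist (x i) (x k)) := by
    rw [Finset.sum_comm]
    exact Finset.sum_congr rfl fun i _ => Finset.sum_congr rfl fun k _ => by rw [dist_comm]
  have hsite : ∑ i ∈ S, siteEnergy lennardJones x i =
      ∑ i ∈ S, ∑ k ∈ S, lennardJones (dist (x i) (x k)) +
        ∑ i ∈ S, ∑ k ∈ Sᶜ, lennardJones (dist (x i) (x k)) := by
    rw [← Finset.sum_add_distrib]
    refine Finset.sum_congr rfl fun i _ => ?_
    rw [siteEnergy_eq_sum, ← Finset.sum_add_sum_compl S]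
  -- assemble
  linarith

end Summit.AtomisticToContinuum.Crystallization.Theorems.KeplerBoundLocalLimit

end
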